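import Summits.CriticalPhenomena.PercolationContinuityZ3.Theorems.FK.InfiniteVolumeFKG
import Summits.CriticalPhenomena.PercolationContinuityZ3.Theorems.FK.InfiniteVolumeInvariance
import Literature.Probability.Percolation.LatticeSymmetry
import Literature.Probability.Percolation.HalfSpacePinnedPairs
import HarnessLib

/-!
# Zhang's argument on `ℤ²`, III: the side-arm events of a square and their rotations
# (Grimmett 2006, proof of Thm. (6.17)(a), (6.22))

Claimed R42 (8)(c) in the cell INBOX at 2026-08-27T21:02:00Z by fkp-10a gen 351 (NEW CLAIM #1 of the gen), addressed to coordinator fk-4 g261 (seated 19:52Z 2026-08-27; records line l.8179) and, if no coordinator is seated, to the lane lead prim-bschramm-lead under provision (ι) (silence = consent); lineage row FO-10a-g351 (self-suggested), package g351-zhang, label ZH-C.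
Support file of the `fk-continuity` cell (lineage fkp-10a, `--supports stmt-CriticalPhenomena-4575`); builds on
p205010 (kernel theorem, internal audit signed; external expert review pending).  No definitions, no named facts,
no sorries; standard axioms.  `d = 2`.

For a lattice square `Q = [a, b]² ⊆ ℤ²` the EAST ARM EVENT (written inline throughout, no definition) is
`A^E(Q) = {ω | ∃ t ∈ Q, t₀ = b, the edge {t, t + e₀} is open and the open cluster of t + e₀ OFF Q is infinite}`
("some vertex of the right side of `Q` lies in an infinite open path using no other vertex of `Q`", Grimmett's
`A^r(n)` in the proof of Thm. (6.17)(a), with the exit edge made explicit).  The other three side events are its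
preimages under the ROTATION `g_Q : z ↦ (a + b - z₁, z₀)` of the square (a signed coordinate permutation followed
by a translation, both of which preserve every box limit `φ^b_{p,q}`: `IsBoxLimit.map_relabel_signedPerm/shift`),
so that the four events have the same probability for free ((6.22), `IsBoxLimit.measure_preimage_relabel_rot`).

* `rot_apply`, `rot_symm_apply`, `rot_mem_sq_iff`, `IsBoxLimit.map_relabel_rot` — the rotation of the square;
* `exists_exit_of_infinite_openCluster` — LAST EXIT: if `x ∈ F` (finite) has an infinite open cluster, some open
  edge `{t, s}` leaves `F` (`t ∈ F`, `s ∉ F`) with the open cluster of `s` off `F` infinite (pigeonhole);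
* `relabel_exitData` — transport of such exit data under a relabelling preserving `Q`;
* `measurableSet_armEvent`, `isUpperSet_armEvent`;
* `mem_armEvent_rot_of_percolates` — `{Q ↔ ∞} ⊆ A^E ∪ g⁻¹A^E ∪ g⁻²A^E ∪ g⁻³A^E` on lattice configurations
  (the square-root trick built on it is in `SelfDualPointNonPercolation.lean`).

## References

* G. Grimmett, *The Random-Cluster Model*, Springer 2006, §6.2, proof of Thm. (6.17)(a), (6.22)–(6.24);
  Thm. (4.17)(b) (positive association), Thm. (4.19)(b) (automorphism invariance). [Grimmett2006]
* G. Grimmett, *Percolation*, 2nd ed., Springer 1999, §11.3, proof of Lemma (11.12), p. 289 (the square-root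
  trick). [GrimmettPercolation1999]
-/

noncomputable section

open scoped Classical
open MeasureTheory Filter Set

namespace Summit.CriticalPhenomena.PercolationContinuityZ3.Theorems.FK

open Literature.Probability.Percolation Literature.Probability.LatticeModels SimpleGraph

/-! ### The rotation of the square `[a, b]²` -/

/-- The rotation `g_Q = shift((a+b) e₀) ∘ (z ↦ (-z₁, z₀))` of the square `[a,b]²` acts as
`z ↦ (a + b - z₁, z₀)`. [folklore] -/
theorem rot_apply (a b : ℤ) (z : Site 2) :
    ((Site.signedPerm (Equiv.swap (0 : Fin 2) 1) ![-1, 1]).trans (Site.shift (Pi.single 0 (a + b)))) z =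
      ![a + b - z 1, z 0] := by
  rw [Site.eq_iff_two]
  simp [Site.signedPerm_apply, Equiv.swap_apply_left, Equiv.swap_apply_right]
  ring

/-- The inverse rotation acts as `z ↦ (z₁, a + b - z₀)`. [folklore] -/
theorem rot_symm_apply (a b : ℤ) (z : Site 2) :
    ((Site.signedPerm (Equiv.swap (0 : Fin 2) 1) ![-1, 1]).trans (Site.shift (Pi.single 0 (a + b)))).symm z =
      ![z 1, a + b - z 0] := by
  rw [Equiv.symm_apply_eq, rot_apply, Site.eq_iff_two]
  simp

/-- The rotation maps the square `[a,b]²` onto itself. [folklore] -/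
theorem rot_mem_sq_iff (a b : ℤ) (z : Site 2) :
    (∀ i, a ≤ ((Site.signedPerm (Equiv.swap (0 : Fin 2) 1) ![-1, 1]).trans
        (Site.shift (Pi.single 0 (a + b)))) z i ∧
      ((Site.signedPerm (Equiv.swap (0 : Fin 2) 1) ![-1, 1]).trans (Site.shift (Pi.single 0 (a + b)))) z i ≤ b) ↔
      ∀ i, a ≤ z i ∧ z i ≤ b := by
  simp only [rot_apply, Fin.forall_fin_two, Matrix.cons_val_zero, Matrix.cons_val_one]
  omega

/-- The inverse rotation maps the square `[a,b]²` onto itself. [folklore] -/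
theorem rot_symm_mem_sq_iff (a b : ℤ) (z : Site 2) :
    (∀ i, a ≤ ((Site.signedPerm (Equiv.swap (0 : Fin 2) 1) ![-1, 1]).trans
        (Site.shift (Pi.single 0 (a + b)))).symm z i ∧
      ((Site.signedPerm (Equiv.swap (0 : Fin 2) 1) ![-1, 1]).trans (Site.shift (Pi.single 0 (a + b)))).symm z i
        ≤ b) ↔ ∀ i, a ≤ z i ∧ z i ≤ b := by
  simp only [rot_symm_apply, Fin.forall_fin_two, Matrix.cons_val_zero, Matrix.cons_val_one]
  omega

variable {b₀ : Bool} {p q : ℝ} {P : Measure (BondConfig (Site 2))}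

/-- **The rotation of a square preserves every box limit** `φ^b_{p,q}` on `ℤ²` (`0 ≤ p ≤ 1`, `q ≥ 1`): it is a
signed coordinate permutation followed by a translation (Grimmett 2006, Thm. (4.19)(b)).
[cite: Grimmett2006, Thm. (4.19)(b)] -/
theorem IsBoxLimit.map_relabel_rot (hP : IsBoxLimit 2 b₀ p q P) (hp : p ∈ Set.Icc (0 : ℝ) 1) (hq : 1 ≤ q)
    (a b : ℤ) :
    P.map (BondConfig.relabel (sym2Equiv ((Site.signedPerm (Equiv.swap (0 : Fin 2) 1) ![-1, 1]).trans
      (Site.shift (Pi.single 0 (a + b)))))) = P := by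
  have hcomp : (BondConfig.relabel (sym2Equiv ((Site.signedPerm (Equiv.swap (0 : Fin 2) 1) ![-1, 1]).trans
      (Site.shift (Pi.single 0 (a + b))))) : BondConfig (Site 2) → BondConfig (Site 2)) =
      BondConfig.relabel (sym2Equiv (Site.shift (Pi.single 0 (a + b)))) ∘
        BondConfig.relabel (sym2Equiv (Site.signedPerm (Equiv.swap (0 : Fin 2) 1) ![-1, 1])) := by
    funext ω
    simp only [Function.comp_apply, BondConfig.relabel_apply, sym2Equiv_apply, Set.image_image]
    refine Set.image_congr' fun e => ?_
    rw [Sym2.map_map]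
    rfl
  rw [hcomp, ← Measure.map_map (MeasurableEquiv.measurable _) (MeasurableEquiv.measurable _),
    hP.map_relabel_signedPerm hp (one_pos.trans_le hq), hP.map_relabel_shift hp hq]

/-- Applied form: `φ{ω | g_Q ω ∈ A} = φ(A)` for every event `A`. [cite: Grimmett2006, Thm. (4.19)(b)] -/
theorem IsBoxLimit.measure_preimage_relabel_rot (hP : IsBoxLimit 2 b₀ p q P) (hp : p ∈ Set.Icc (0 : ℝ) 1)
    (hq : 1 ≤ q) (a b : ℤ) (A : Set (BondConfig (Site 2))) :
    P (BondConfig.relabel (sym2Equiv ((Site.signedPerm (Equiv.swap (0 : Fin 2) 1) ![-1, 1]).trans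
      (Site.shift (Pi.single 0 (a + b))))) ⁻¹' A) = P A := by
  conv_rhs => rw [← hP.map_relabel_rot hp hq a b]
  rw [MeasurableEquiv.map_apply]

/-! ### Exit data: an open edge leaving a set, with an infinite cluster beyond it -/

/-- **Last exit of an infinite cluster from a finite set.**  On a locally finite graph, if `x ∈ F`, `F` finite,
lies in an infinite open cluster of a configuration `ω ⊆ E(G)`, then some open edge `{t, s}` with `t ∈ F`,
`s ∉ F` is such that the open cluster of `s` in the complement of `F` is infinite (every vertex of `C(x) ∖ F` is
reached from the far endpoint of the last exit edge of an open path from `x`; there are finitely many such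
edges). [folklore] -/
theorem exists_exit_of_infinite_openCluster {V : Type*} {G : SimpleGraph V} [G.LocallyFinite]
    {ω : BondConfig V} (hω : ω ⊆ G.edgeSet) {F : Set V} (hF : F.Finite) {x : V} (hx : x ∈ F)
    (hC : (openCluster ω x).Infinite) :
    ∃ t ∈ F, ∃ s ∉ F, s(t, s) ∈ ω ∧ {z | ω ∈ openConnIn Fᶜ s z}.Infinite := by
  -- last exit of an open walk from a vertex outside `F` to a vertex of `F`, read backwards
  have key : ∀ (y x₀ : V) (w : (openGraph ω).Walk y x₀), x₀ ∈ F → y ∉ F →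
      ∃ t ∈ F, ∃ s ∉ F, s(t, s) ∈ ω ∧ ω ∈ openConnIn Fᶜ s y := by
    intro y x₀ w
    induction w with
    | nil => intro h h'; exact absurd h h'
    | cons h w ih =>
      rename_i y y' x'
      intro hx' hy
      by_cases hy' : y' ∈ F
      · refine ⟨y', hy', y, hy, ?_, hy, hy, Reachable.refl _⟩
        rw [Sym2.eq_swap]; exact ((openGraph_adj ω y y').1 h).1
      · obtain ⟨t, ht, s, hs, hts, hconn⟩ := ih hx' hy'
        obtain ⟨hsF, hy'F, hreach⟩ : ∃ (h1 : s ∈ Fᶜ) (h2 : y' ∈ Fᶜ),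
            ((openGraph ω).induce Fᶜ).Reachable ⟨s, h1⟩ ⟨y', h2⟩ := hconn
        refine ⟨t, ht, s, hs, hts, hsF, hy, SimpleGraph.Reachable.trans hreach (Adj.reachable ?_)⟩
        rw [induce_adj]
        exact h.symm
  -- the finitely many candidate exit pairs
  set Pairs : Set (V × V) := ⋃ t ∈ F, (fun s => (t, s)) '' (G.neighborSet t) with hPairs
  have hPf : Pairs.Finite := hF.biUnion fun t _ => (G.neighborSet t).toFinite.image _
  have hcover : openCluster ω x \ F ⊆ ⋃ pr ∈ Pairs, {z | s(pr.1, pr.2) ∈ ω ∧ ω ∈ openConnIn Fᶜ pr.2 z} := by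
    rintro y ⟨hy, hyF⟩
    obtain ⟨t, ht, s, hs, hts, hconn⟩ := key y x (Classical.choice hy).reverse hx hyF
    have hadj : G.Adj t s := by
      have := hω hts; rwa [mem_edgeSet] at this
    refine Set.mem_iUnion₂.2 ⟨(t, s), ?_, hts, hconn⟩
    exact Set.mem_iUnion₂.2 ⟨t, ht, s, hadj, rfl⟩
  by_contra hnone
  push Not at hnone
  have hfin : (⋃ pr ∈ Pairs, {z | s(pr.1, pr.2) ∈ ω ∧ ω ∈ openConnIn Fᶜ pr.2 z}).Finite := by
    refine hPf.biUnion fun pr hpr => ?_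
    by_cases hprω : s(pr.1, pr.2) ∈ ω
    · have h1 : pr.1 ∈ F := by
        obtain ⟨t, ht, s, -, rfl⟩ := Set.mem_iUnion₂.1 hpr; exact ht
      by_cases h2 : pr.2 ∈ F
      · refine Set.Finite.subset (Set.finite_empty) fun z ⟨_, hz⟩ => ?_
        exact absurd hz.1 (fun h => h h2)
      · exact (hnone pr.1 h1 pr.2 h2 hprω).subset fun z hz => hz.2
    · exact Set.Finite.subset Set.finite_empty fun z hz => absurd hz.1 hprω
  exact hC (((hfin.subset hcover).union hF).subset (Set.subset_sdiff_union _ _))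

/-- **Transport of exit data by a relabelling preserving `Q`.**  If `φ : ℤ² ≃ ℤ²` maps the square `[a,b]²` into
itself... precisely: if `z ∈ Q ↔ φ z ∈ Q` for all `z`, then an open edge `{t, s}` of `ω` with an infinite open cluster
of `s` off `Q` is carried to the open edge `{φ t, φ s}` of `φ ω` with an infinite open cluster of `φ s` off `Q`.
[folklore] -/
theorem relabel_exitData {a b : ℤ} (φ : Site 2 ≃ Site 2)
    (hφ : ∀ z, (∀ i, a ≤ φ z i ∧ φ z i ≤ b) ↔ ∀ i, a ≤ z i ∧ z i ≤ b) {ω : BondConfig (Site 2)} {t s : Site 2}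
    (hts : s(t, s) ∈ ω) (hinf : {z | ω ∈ openConnIn {v | ¬ ∀ i, a ≤ v i ∧ v i ≤ b} s z}.Infinite) :
    s(φ t, φ s) ∈ BondConfig.relabel (sym2Equiv φ) ω ∧
      {z | BondConfig.relabel (sym2Equiv φ) ω ∈ openConnIn {v | ¬ ∀ i, a ≤ v i ∧ v i ≤ b} (φ s) z}.Infinite := by
  constructor
  · rw [BondConfig.mem_relabel_iff, sym2Equiv_symm, sym2Equiv_mk, φ.symm_apply_apply, φ.symm_apply_apply]
    exact hts
  · have himg : φ '' {v : Site 2 | ¬ ∀ i, a ≤ v i ∧ v i ≤ b} = {v | ¬ ∀ i, a ≤ v i ∧ v i ≤ b} := by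
      ext v
      constructor
      · rintro ⟨y, hy, rfl⟩ h
        exact hy ((hφ y).1 h)
      · intro hv
        refine ⟨φ.symm v, fun h => hv ?_, φ.apply_symm_apply v⟩
        have := (hφ (φ.symm v)).2 h
        rwa [φ.apply_symm_apply] at this
    refine ((hinf.image φ.injective.injOn)).mono ?_
    rintro _ ⟨z, hz, rfl⟩
    have h := relabel_mem_openConnIn φ hz
    rwa [himg] at h

/-! ### The east arm event: measurability and monotonicity -/

/-- A finite set of sites of `ℤ²` is contained in some box `Λ_n`. [folklore] -/
theorem exists_subset_box_of_finite {T : Set (Site 2)} (hT : T.Finite) : ∃ n : ℕ, T ⊆ ↑(box 2 n) := by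
  induction T, hT using Set.Finite.induction_on with
  | empty => exact ⟨0, by simp⟩
  | @insert v T _ _ ih =>
    obtain ⟨n, hn⟩ := ih
    refine ⟨max n (max (v 0).natAbs (v 1).natAbs), ?_⟩
    rintro z (rfl | hz)
    · rw [Finset.mem_coe, mem_box, Fin.forall_fin_two]
      omega
    · have h := mem_box.1 (hn hz)
      rw [Finset.mem_coe, mem_box]
      intro i
      have := h i
      constructor <;> omega

/-- `{z | x ↔ z off Q}` is infinite iff it is not contained in any box. [folklore] -/
theorem setOf_openConnIn_infinite_iff (S : Set (Site 2)) (x : Site 2) (ω : BondConfig (Site 2)) :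
    {z | ω ∈ openConnIn S x z}.Infinite ↔ ∀ n : ℕ, ∃ z, z ∉ box 2 n ∧ ω ∈ openConnIn S x z := by
  constructor
  · intro h n
    obtain ⟨z, hz, hzn⟩ := h.exists_notMem_finset (box 2 n)
    exact ⟨z, hzn, hz⟩
  · intro h hfin
    obtain ⟨n, hn⟩ := exists_subset_box_of_finite hfin
    obtain ⟨z, hzn, hz⟩ := h n
    exact hzn (hn hz)

/-- The east arm event of the square `[a,b]²` is measurable. [folklore] -/
theorem measurableSet_armEvent (a b : ℤ) :
    MeasurableSet {ω : BondConfig (Site 2) | ∃ t : Site 2, (∀ i, a ≤ t i ∧ t i ≤ b) ∧ t 0 = b ∧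
      s(t, t + Pi.single 0 1) ∈ ω ∧
      {z | ω ∈ openConnIn {v | ¬ ∀ i, a ≤ v i ∧ v i ≤ b} (t + Pi.single 0 1) z}.Infinite} := by
  have h : {ω : BondConfig (Site 2) | ∃ t : Site 2, (∀ i, a ≤ t i ∧ t i ≤ b) ∧ t 0 = b ∧
      s(t, t + Pi.single 0 1) ∈ ω ∧
      {z | ω ∈ openConnIn {v | ¬ ∀ i, a ≤ v i ∧ v i ≤ b} (t + Pi.single 0 1) z}.Infinite} =
      ⋃ t : Site 2, {ω | (∀ i, a ≤ t i ∧ t i ≤ b) ∧ t 0 = b} ∩ ({ω | s(t, t + Pi.single 0 1) ∈ ω} ∩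
        ⋂ n : ℕ, ⋃ z : Site 2, {ω | z ∉ box 2 n} ∩
          openConnIn {v | ¬ ∀ i, a ≤ v i ∧ v i ≤ b} (t + Pi.single 0 1) z) := by
    ext ω
    simp only [Set.mem_setOf_eq, Set.mem_iUnion, Set.mem_inter_iff, Set.mem_iInter, setOf_openConnIn_infinite_iff]
    constructor
    · rintro ⟨t, ht, ht0, he, hinf⟩
      exact ⟨t, ⟨ht, ht0⟩, he, fun n => by obtain ⟨z, hz, hz'⟩ := hinf n; exact ⟨z, hz, hz'⟩⟩
    · rintro ⟨t, ⟨ht, ht0⟩, he, hinf⟩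
      exact ⟨t, ht, ht0, he, fun n => by obtain ⟨z, hz, hz'⟩ := hinf n; exact ⟨z, hz, hz'⟩⟩
  rw [h]
  refine MeasurableSet.iUnion fun t => (MeasurableSet.const _).inter ((measurableSet_mem _).inter
    (MeasurableSet.iInter fun n => MeasurableSet.iUnion fun z => (MeasurableSet.const _).inter
      (measurableSet_openConnIn_of_countable _ _ _)))

/-- The east arm event of the square `[a,b]²` is increasing. [folklore] -/
theorem isUpperSet_armEvent (a b : ℤ) :
    IsUpperSet {ω : BondConfig (Site 2) | ∃ t : Site 2, (∀ i, a ≤ t i ∧ t i ≤ b) ∧ t 0 = b ∧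
      s(t, t + Pi.single 0 1) ∈ ω ∧
      {z | ω ∈ openConnIn {v | ¬ ∀ i, a ≤ v i ∧ v i ≤ b} (t + Pi.single 0 1) z}.Infinite} := by
  rintro ω ω' hle ⟨t, ht, ht0, he, hinf⟩
  exact ⟨t, ht, ht0, hle he, hinf.mono fun z hz => isUpperSet_openConnIn _ _ _ hle hz⟩

/-! ### `{Q ↔ ∞}` is covered by the four rotated arm events -/

/-- **`{Q ↔ ∞} ⊆ A^E ∪ g⁻¹ A^E ∪ g⁻² A^E ∪ g⁻³ A^E`** for the square `Q = [a,b]²` (`a ≤ b`) and a lattice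
configuration `ω`: an infinite open cluster meeting `Q` leaves `Q` a last time through an open edge `{t, t ± eᵢ}`
beyond which it is infinite off `Q` (`exists_exit_of_infinite_openCluster`); rotating by `g_Q` zero to three times
turns that edge into an eastward exit `{t', t' + e₀}`. [cite: Grimmett2006, §6.2 proof of Thm. (6.17)(a) ("whose union equals the event {T(n) ↔ ∞}")] -/
theorem mem_armEvent_rot_of_percolates {a b : ℤ} {ω : BondConfig (Site 2)}
    (hω : ω ⊆ (zdGraph 2).edgeSet) {x : Site 2} (hxQ : ∀ i, a ≤ x i ∧ x i ≤ b) (hx : ω ∈ percolatesAt x) :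
    ∃ k : ℕ, k < 4 ∧ (BondConfig.relabel (sym2Equiv ((Site.signedPerm (Equiv.swap (0 : Fin 2) 1) ![-1, 1]).trans
      (Site.shift (Pi.single 0 (a + b))))))^[k] ω ∈
      {ω : BondConfig (Site 2) | ∃ t : Site 2, (∀ i, a ≤ t i ∧ t i ≤ b) ∧ t 0 = b ∧
        s(t, t + Pi.single 0 1) ∈ ω ∧
        {z | ω ∈ openConnIn {v | ¬ ∀ i, a ≤ v i ∧ v i ≤ b} (t + Pi.single 0 1) z}.Infinite} := by
  set g := (Site.signedPerm (Equiv.swap (0 : Fin 2) 1) ![-1, 1]).trans (Site.shift (Pi.single 0 (a + b)))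
    with hg
  have hgQ : ∀ z, (∀ i, a ≤ g z i ∧ g z i ≤ b) ↔ ∀ i, a ≤ z i ∧ z i ≤ b := rot_mem_sq_iff a b
  have hg0 : ∀ z, g z 0 = a + b - z 1 := fun z => by rw [hg, rot_apply]; simp
  have hg1 : ∀ z, g z 1 = z 0 := fun z => by rw [hg, rot_apply]; simp
  -- the square is finite
  have hQfin : ({v : Site 2 | ∀ i, a ≤ v i ∧ v i ≤ b}).Finite := by
    refine (box 2 (max a.natAbs b.natAbs)).finite_toSet.subset fun v hv => ?_
    rw [Finset.mem_coe, mem_box]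
    intro i
    have := hv i
    constructor <;> omega
  obtain ⟨t, htQ, s, hsQ, hts, hinf⟩ := exists_exit_of_infinite_openCluster hω hQfin hxQ hx
  have hadj : (zdGraph 2).Adj t s := by have := hω hts; rwa [mem_edgeSet] at this
  have hsQ' : ¬ ∀ i, a ≤ s i ∧ s i ≤ b := hsQ
  have htQ' : ∀ i, a ≤ t i ∧ t i ≤ b := htQ
  have hinf' : {z | ω ∈ openConnIn {v | ¬ ∀ i, a ≤ v i ∧ v i ≤ b} s z}.Infinite := by
    simpa only [Set.compl_setOf] using hinf
  -- exit data after 0, 1, 2, 3 rotations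
  have step : ∀ (η : BondConfig (Site 2)) (t' s' : Site 2), s(t', s') ∈ η →
      {z | η ∈ openConnIn {v | ¬ ∀ i, a ≤ v i ∧ v i ≤ b} s' z}.Infinite →
      s(g t', g s') ∈ BondConfig.relabel (sym2Equiv g) η ∧
        {z | BondConfig.relabel (sym2Equiv g) η ∈
          openConnIn {v | ¬ ∀ i, a ≤ v i ∧ v i ≤ b} (g s') z}.Infinite :=
    fun η t' s' h1 h2 => relabel_exitData g hgQ h1 h2
  obtain ⟨hts₁, hinf₁⟩ := step ω t s hts hinf'
  obtain ⟨hts₂, hinf₂⟩ := step _ _ _ hts₁ hinf₁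
  obtain ⟨hts₃, hinf₃⟩ := step _ _ _ hts₂ hinf₂
  rw [Fin.forall_fin_two] at htQ' hsQ'
  rcases stepKind_of_adj hadj with ⟨h0, h1⟩ | ⟨h0, h1⟩ | ⟨h1, h0⟩ | ⟨h1, h0⟩
  · -- eastward exit: `s = t + e₀`, no rotation
    have hs : s = t + Pi.single 0 1 := by rw [Site.eq_iff_two]; simp; omega
    refine ⟨0, by omega, ?_⟩
    simp only [Function.iterate_zero, id_eq, Set.mem_setOf_eq]
    exact ⟨t, htQ, by omega, hs ▸ hts, hs ▸ hinf'⟩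
  · -- westward exit: `s = t - e₀`, two rotations
    refine ⟨2, by omega, ?_⟩
    simp only [Function.iterate_succ, Function.iterate_zero, Function.comp_apply, id_eq, Set.mem_setOf_eq]
    have hgt : ∀ i, a ≤ g (g t) i ∧ g (g t) i ≤ b := (hgQ _).2 ((hgQ _).2 htQ)
    have hs : g (g s) = g (g t) + Pi.single 0 1 := by
      rw [Site.eq_iff_two]
      simp only [hg0, hg1, Pi.add_apply, single_zero_apply_zero, single_zero_apply_one, add_zero]
      omega
    refine ⟨g (g t), hgt, ?_, hs ▸ hts₂, hs ▸ hinf₂⟩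
    rw [hg0, hg1]; omega
  · -- northward exit: `s = t + e₁`, three rotations
    refine ⟨3, by omega, ?_⟩
    simp only [Function.iterate_succ, Function.iterate_zero, Function.comp_apply, id_eq, Set.mem_setOf_eq]
    have hgt : ∀ i, a ≤ g (g (g t)) i ∧ g (g (g t)) i ≤ b := (hgQ _).2 ((hgQ _).2 ((hgQ _).2 htQ))
    have hs : g (g (g s)) = g (g (g t)) + Pi.single 0 1 := by
      rw [Site.eq_iff_two]
      simp only [hg0, hg1, Pi.add_apply, single_zero_apply_zero, single_zero_apply_one, add_zero]
      omega
    refine ⟨g (g (g t)), hgt, ?_, hs ▸ hts₃, hs ▸ hinf₃⟩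
    rw [hg0, hg1, hg0]; omega
  · -- southward exit: `s = t - e₁`, one rotation
    refine ⟨1, by omega, ?_⟩
    simp only [Function.iterate_succ, Function.iterate_zero, Function.comp_apply, id_eq, Set.mem_setOf_eq]
    have hgt : ∀ i, a ≤ g t i ∧ g t i ≤ b := (hgQ _).2 htQ
    have hs : g s = g t + Pi.single 0 1 := by
      rw [Site.eq_iff_two]
      simp only [hg0, hg1, Pi.add_apply, single_zero_apply_zero, single_zero_apply_one, add_zero]
      omega
    refine ⟨g t, hgt, ?_, hs ▸ hts₁, hs ▸ hinf₁⟩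
    rw [hg0]; omega


end Summit.CriticalPhenomena.PercolationContinuityZ3.Theorems.FK

end
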